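import Mathlib
import Literature.AlgebraicGeometry.Resolution.ProperBirationalGlobalSections
import Literature.AlgebraicGeometry.Modules.SectionsExact
import Summits.ResolutionOfSingularities.ResolutionOfSingularities.Theorems.HomologicalConductorNoZenoFullSheafPresentation
import HarnessLib

/-!
# Crux `NoZenoR` (stmt-ResolutionOfSingularities-19943), line `sandwich-cluster`, G-layer G2 (vii), part 1a:
# coordinates on `𝒪_X^n`, the presentation on coordinates, and «the presentation kernel is generically
# generated by the `T`-relations among the generators»

OURS (cell res-hironaka, chain W4.4; G2 «full-sheaf package» clause (vii) = (W) of the holder's cut,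
res-D-pv-045 AS res-L0-w44-stub-8 `SketchG2Split.lean` v2; seat res-D-pv-024). Nothing of
[claim: Hironaka2017] is used; AI-written, weaker than expert review.

Setting: `π : X ⟶ Spec T` a resolution of a domain `T` (so `K(X) = Frac T`,
`isFractionRing_baseToFunctionField`), `M` a `T`-module with generators `m : Fin n → M`,
`φ : M →+ K(X)^r` injective and `T`-semilinear, the full sheaf `M~ = 𝒪_X · φ(M)` and its presentation
`q : 𝒪_X^n ⟶ M~` (`presentation`, p505917) with kernel `𝒦 = ker q`.

* `ιFree_app_one`, `app_sum_apply`, `exists_coords_freeMod` — every section of `𝒪_X^n = freeMod X n`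
  over `V` is `∑ c_k • e_k|_V` (`𝒪_X^n ≅ ⨁ 𝒪_X`, `∑ πₖ ιₖ = 𝟙`);
* `fn_sum`, `presentation_app_sum_smul`, `presentation_app_sum_algebraMapΓ_smul`,
  `presentation_app_sum_eq_zero_of_relation` — `q(∑ g_k • e_k|_V) = ∑ g_k • σ_{φ m_k}|_V`; for
  `T`-coordinates `a` this is `σ_{φ(∑ a_k m_k)}|_V`, which vanishes for a relation `∑ a_k m_k = 0`;
* **`exists_smul_kernel_section_eq`** — for a section `x` of `𝒦` over a non-empty `V` there are
  `s ∈ T ∖ 0` and a relation `a` with `s|_V • κ(x) = ∑ a_k|_V • e_k|_V` (clear the denominators of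
  the coordinates of `x` in `K(X) = Frac T`; the numerators form a relation because `φ` is injective).

References: O. Iyama, M. Wemyss, Math. Z. 265 (2010), Thm. 2.7 [`IyamaWemyss2009`]; M. Artin,
J.-L. Verdier, Math. Ann. 270 (1985), (1.1) [`ArtinVerdier1985`].
-/

-- single-problem summit: the doubled namespace component `ResolutionOfSingularities` is forced
set_option linter.dupNamespace false

noncomputable section

universe u

open CategoryTheory CategoryTheory.Limits AlgebraicGeometry TopologicalSpace Opposite
open Literature.AlgebraicGeometry.Resolution Literature.AlgebraicGeometry.Morphisms
open Literature.AlgebraicGeometry.Modules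

namespace Summit.ResolutionOfSingularities.ResolutionOfSingularities.Theorems.NoZeno.SandwichCluster.FullSheaf

variable {X : Scheme.{u}}

/-! ## Coordinates on the sections of `𝒪_X^n` -/

/-- The `k`-th basis section of `𝒪_X^n` over `V` is the image of `1 ∈ Γ(V, 𝒪_X)` under the `k`-th
coprojection `𝒪_X ⟶ 𝒪_X^n`. [this work] -/
theorem ιFree_app_one (n : ℕ) (k : Fin n) (V : X.Opens) :
    (show (unitModule X ⟶ freeMod X n) from SheafOfModules.ιFree (ULift.up k)).app V (1 : Γ(X, V)) =
      ((SheafOfModules.freeSection (R := X.ringCatSheaf) (ULift.up k)).val (op V) :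
        Γ(freeMod X n, V)) := by
  rfl

/-- `Γ(V, φ)` of a finite sum of morphisms. [this work] -/
theorem app_sum_apply {M N : X.Modules} {J : Type*} (s : Finset J) (φ : J → (M ⟶ N)) (V : X.Opens)
    (x : Γ(M, V)) : (∑ j ∈ s, φ j).app V x = ∑ j ∈ s, (φ j).app V x := by
  classical
  induction s using Finset.induction_on with
  | empty => rw [Finset.sum_empty, Finset.sum_empty]; rfl
  | insert j s hj ih =>
    rw [Finset.sum_insert hj, Finset.sum_insert hj, Scheme.Modules.Hom.add_app, ← ih]
    rfl

/-- **Coordinates on `Γ(V, 𝒪_X^n)`**: every section of `𝒪_X^n = freeMod X n` over an open `V` is a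
`Γ(V, 𝒪_X)`-linear combination of the basis sections `e_k|_V` (through `𝒪_X^n ≅ ⨁_k 𝒪_X` and the
biproduct identity `∑ πₖ ιₖ = 𝟙`; the `k`-th coordinate is `πₖ`). [this work] -/
theorem exists_coords_freeMod (n : ℕ) (V : X.Opens) (x : Γ(freeMod X n, V)) :
    ∃ c : Fin n → Γ(X, V), x = ∑ k, c k •
      (show (unitModule X ⟶ freeMod X n) from SheafOfModules.ιFree (ULift.up k)).app V (1 : Γ(X, V)) := by
  classical
  haveI : HasFiniteBiproducts X.Modules := HasFiniteBiproducts.of_hasFiniteProducts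
  let F : ULift.{u} (Fin n) → X.Modules := fun _ => unitModule X
  -- `𝒪_X^n` (a coproduct) is the biproduct
  let e : ⨁ F ≅ freeMod X n := biproduct.isoCoproduct F
  have hι : ∀ k : ULift.{u} (Fin n), biproduct.ι F k ≫ e.hom =
      (show (unitModule X ⟶ freeMod X n) from SheafOfModules.ιFree k) := fun k => by
    change biproduct.ι F k ≫ (biproduct.isoCoproduct F).hom = Sigma.ι F k
    rw [biproduct.isoCoproduct_hom, biproduct.ι_desc]
  have htot : ∑ k, biproduct.π F k ≫ biproduct.ι F k = 𝟙 (⨁ F) :=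
    Limits.IsBilimit.total (biproduct.isBilimit F)
  -- coordinates of `x' = e⁻¹ x`: `c_k = π_k x'`
  let x' : Γ(⨁ F, V) := e.inv.app V x
  obtain ⟨c, hc⟩ : ∃ c : ULift.{u} (Fin n) → Γ(X, V), ∀ k,
      (show Γ(unitModule X, V) from c k) = (biproduct.π F k).app V x' := ⟨_, fun _ => rfl⟩
  refine ⟨fun k => c (ULift.up k), ?_⟩
  have hx : x = e.hom.app V x' := by
    change x = (e.inv ≫ e.hom).app V x
    rw [e.inv_hom_id]; rfl
  have hx' : x' = ∑ k, (biproduct.ι F k).app V (show Γ(unitModule X, V) from c k) := by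
    conv_lhs => rw [show x' = (𝟙 (⨁ F) : ⨁ F ⟶ ⨁ F).app V x' from rfl, ← htot, app_sum_apply]
    refine Finset.sum_congr rfl fun k _ => ?_
    rw [hc k]; rfl
  rw [hx, hx', map_sum, ← (Equiv.ulift : ULift.{u} (Fin n) ≃ Fin n).symm.sum_comp]
  refine Finset.sum_congr rfl fun k _ => ?_
  change (biproduct.ι F (ULift.up k) ≫ e.hom).app V _ = _
  rw [hι, ← Scheme.Modules.Hom.app_smul]
  congr 1
  change c (ULift.up k) = c (ULift.up k) * 1
  rw [mul_one]

/-! ## The presentation on coordinates; relations give kernel sections -/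

section Relations

variable [IsIntegral X] (V' : Type u) [AddCommGroup V'] [Module X.functionField V'] (S : Set V')

/-- `fn` of a finite sum of sections. [this work] -/
theorem fn_sum {J : Type*} (s : Finset J) {V : X.Opens} (σ : J → Γ(generatedSheaf V' S, V)) (y : V) :
    fn V' S (∑ j ∈ s, σ j) y = ∑ j ∈ s, fn V' S (σ j) y := by
  classical
  induction s using Finset.induction_on with
  | empty => rw [Finset.sum_empty, Finset.sum_empty, fn_zero]; rfl
  | insert j s hj ih => rw [Finset.sum_insert hj, Finset.sum_insert hj, fn_add, Pi.add_apply, ih]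

/-- **The presentation on coordinates**: `q(∑ g_k • e_k|_V) = ∑ g_k • σ_{s k}|_V`. [this work] -/
theorem presentation_app_sum_smul {n : ℕ} (s : Fin n → S) (V : X.Opens) (g : Fin n → Γ(X, V)) :
    (presentation (X := X) V' S s).app V (∑ k, g k •
        (show (unitModule X ⟶ freeMod X n) from SheafOfModules.ιFree (ULift.up k)).app V (1 : Γ(X, V))) =
      ∑ k, g k • (ofMem V' S V (s k).1 (s k).2 : Γ(generatedSheaf V' S, V)) := by
  rw [map_sum]
  refine Finset.sum_congr rfl fun k _ => ?_
  rw [Scheme.Modules.Hom.app_smul, ιFree_app_one, presentation_app_freeSection]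

end Relations

section Base

variable [IsIntegral X] {T : Type u} [CommRing T] (π : X ⟶ Spec (.of T))
variable {M : Type u} [AddCommGroup M] [Module T M] {r : ℕ} (φ : M →+ (Fin r → X.functionField))

/-- **Values of the presentation on `T`-coordinates**: for `a : Fin n → T`,
`q(∑ a_k|_V • e_k|_V) = σ_{φ(∑ a_k m_k)}|_V`. [this work] -/
theorem presentation_app_sum_algebraMapΓ_smul
    (hφ : ∀ (a : T) (m : M), φ (a • m) = baseToFunctionField π a • φ m)
    {n : ℕ} (m : Fin n → M) (V : X.Opens) [Nonempty V] (a : Fin n → T) :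
    (presentation (X := X) (Fin r → X.functionField) (Set.range φ)
        (fun k => (⟨φ (m k), m k, rfl⟩ : Set.range φ))).app V
      (∑ k, X.presheaf.map (homOfLE (le_top : V ≤ ⊤)).op (algebraMapΓ π (a k)) •
        (show (unitModule X ⟶ freeMod X n) from SheafOfModules.ιFree (ULift.up k)).app V (1 : Γ(X, V))) =
      ofMem (Fin r → X.functionField) (Set.range φ) V (φ (Fintype.linearCombination T m a))
        ⟨_, rfl⟩ := by
  rw [presentation_app_sum_smul]
  refine section_ext _ _ (funext fun y => ?_)
  rw [fn_sum, fn_ofMem, Fintype.linearCombination_apply, map_sum]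
  refine Finset.sum_congr rfl fun k _ => ?_
  rw [fn_smul, fn_ofMem, evalFn_res_algebraMapΓ, hφ]

/-- **A `T`-relation among the generators gives a section of the presentation kernel**:
if `∑ a_k m_k = 0` then `q(∑ a_k|_V • e_k|_V) = 0`. [this work] -/
theorem presentation_app_sum_eq_zero_of_relation
    (hφ : ∀ (a : T) (m : M), φ (a • m) = baseToFunctionField π a • φ m)
    {n : ℕ} (m : Fin n → M) (V : X.Opens) (a : Fin n → T)
    (ha : Fintype.linearCombination T m a = 0) :
    (presentation (X := X) (Fin r → X.functionField) (Set.range φ)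
        (fun k => (⟨φ (m k), m k, rfl⟩ : Set.range φ))).app V
      (∑ k, X.presheaf.map (homOfLE (le_top : V ≤ ⊤)).op (algebraMapΓ π (a k)) •
        (show (unitModule X ⟶ freeMod X n) from SheafOfModules.ιFree (ULift.up k)).app V (1 : Γ(X, V))) =
      0 := by
  rcases isEmpty_or_nonempty V with hV | hV
  · exact section_eq_zero_of_isEmpty _ _ hV _
  · rw [presentation_app_sum_algebraMapΓ_smul π φ hφ m V a]
    refine section_ext _ _ (funext fun y => ?_)
    rw [fn_ofMem, ha, map_zero, fn_zero, Pi.zero_apply]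

/-- **The presentation kernel is generically generated by the `T`-relations.** For a section `x` of
`𝒦 = ker q` over a NON-EMPTY open `V` there are `s ∈ T`, `s ≠ 0`, and a `T`-relation `a`
(`∑ a_k m_k = 0`) with `s|_V • κ(x) = ∑ a_k|_V • e_k|_V`: write `κ(x) = ∑ c_k • e_k|_V`
(`exists_coords_freeMod`); `q(κ x) = 0` says `∑ c_k(η) φ(m_k) = 0` in `K(X)^r`; clear the denominators of
the `c_k(η) ∈ K(X) = Frac T` (`isFractionRing_baseToFunctionField`): `s c_k(η) = a_k`, and
`φ(∑ a_k m_k) = s ∑ c_k(η) φ(m_k) = 0` forces `∑ a_k m_k = 0` (`φ` injective); finally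
`Γ(V, 𝒪_X) → K(X)` is injective (`evalFn_injective`). [this work] -/
theorem exists_smul_kernel_section_eq [IsDomain T] (hπ : IsResolution π)
    (hφ : ∀ (a : T) (m : M), φ (a • m) = baseToFunctionField π a • φ m)
    (hφinj : Function.Injective φ) {n : ℕ} (m : Fin n → M) (V : X.Opens) [Nonempty V]
    (x : Γ(kernel (presentation (X := X) (Fin r → X.functionField) (Set.range φ)
      (fun k => (⟨φ (m k), m k, rfl⟩ : Set.range φ))), V)) :
    ∃ (s : T) (_ : s ≠ 0) (a : Fin n → T), Fintype.linearCombination T m a = 0 ∧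
      X.presheaf.map (homOfLE (le_top : V ≤ ⊤)).op (algebraMapΓ π s) •
          (kernel.ι (presentation (X := X) (Fin r → X.functionField) (Set.range φ)
            (fun k => (⟨φ (m k), m k, rfl⟩ : Set.range φ)))).app V x =
        ∑ k, X.presheaf.map (homOfLE (le_top : V ≤ ⊤)).op (algebraMapΓ π (a k)) •
          (show (unitModule X ⟶ freeMod X n) from SheafOfModules.ιFree (ULift.up k)).app V
            (1 : Γ(X, V)) := by
  obtain ⟨y₀⟩ := ‹Nonempty V›
  -- coordinates of `κ x`
  obtain ⟨c, hc⟩ := exists_coords_freeMod n V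
    ((kernel.ι (presentation (X := X) (Fin r → X.functionField) (Set.range φ)
      (fun k => (⟨φ (m k), m k, rfl⟩ : Set.range φ)))).app V x)
  -- `q (κ x) = 0`: `∑ c_k(η) • φ(m_k) = 0`
  have hrel : ∑ k, evalFn V y₀ (c k) • φ (m k) = 0 := by
    have h0 := app_kernel_ι_app (presentation (X := X) (Fin r → X.functionField) (Set.range φ)
      (fun k => (⟨φ (m k), m k, rfl⟩ : Set.range φ))) V x
    rw [hc, presentation_app_sum_smul] at h0
    have h1 := congrArg (fun σ => fn (Fin r → X.functionField) (Set.range φ) σ y₀) h0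
    simp only [fn_sum, fn_smul, fn_ofMem, fn_zero] at h1
    exact h1
  -- clear denominators in `K(X) = Frac T`
  letI := (baseToFunctionField π).toAlgebra
  haveI : IsDominant π := hπ.isBirational.isDominant
  haveI : IsFractionRing T X.functionField :=
    isFractionRing_baseToFunctionField π hπ.isBirational.isIso_stalkMap_genericPoint
  obtain ⟨⟨s, hs⟩, hint⟩ := IsLocalization.exist_integer_multiples_of_finite (nonZeroDivisors T)
    (fun k => evalFn V y₀ (c k))
  choose a ha using fun k => hint k
  have ha' : ∀ k, baseToFunctionField π (a k) = baseToFunctionField π s * evalFn V y₀ (c k) :=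
    fun k => by
      have h := ha k
      rw [Algebra.smul_def] at h
      exact h
  refine ⟨s, nonZeroDivisors.ne_zero hs, a, ?_, ?_⟩
  · -- the numerators form a relation
    apply hφinj
    rw [map_zero]
    calc φ (Fintype.linearCombination T m a)
        = ∑ k, baseToFunctionField π (a k) • φ (m k) := by
          rw [Fintype.linearCombination_apply, map_sum]
          exact Finset.sum_congr rfl fun k _ => hφ _ _
      _ = baseToFunctionField π s • ∑ k, evalFn V y₀ (c k) • φ (m k) := by
          rw [Finset.smul_sum]
          exact Finset.sum_congr rfl fun k _ => by rw [ha', mul_smul]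
      _ = 0 := by rw [hrel, smul_zero]
  · -- `s|_V • κ x = ∑ a_k|_V • e_k|_V`, comparing coordinates in `K(X)`
    rw [hc, Finset.smul_sum]
    refine Finset.sum_congr rfl fun k _ => ?_
    rw [smul_smul]
    congr 1
    apply evalFn_injective V y₀
    rw [map_mul, evalFn_res_algebraMapΓ, evalFn_res_algebraMapΓ, ha']

end Base

end Summit.ResolutionOfSingularities.ResolutionOfSingularities.Theorems.NoZeno.SandwichCluster.FullSheaf

end
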